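/-
Copyright: seat `ym-line-sll-p3` (prover-ym-line-sll-p3-g0-0), route `SoftLoopLongLag`, crux `SoftLoopLagFloorToTorus`
(stmt-QuantumFields-22504), line `birth` (skeleton `Cruxes/SoftLoopLagFloorToTorus/Lines/birth.lean`).
-/
import Summits.QuantumFields.YangMills.Theorems.SoftLoopLongLagSoftLoopLagFloorToTorusStubLimitPassageG
import Summits.QuantumFields.YangMills.Theorems.ColdBoxAllGroupsBulkAllGroupsDlrPlumbingG
import Literature.MathematicalPhysics.QuantumLattice.LatticeGaugeDLRCovarianceSplit

/-!
# Registered stub K1 `stub_dlrTransferG` of crux `SoftLoopLagFloorToTorus` (stmt-QuantumFields-22504), line `birth` —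
# part 1 of 3: PLUMBING (conditioning a kernel on a typical event; lattice geometry of the soft loops and of the lag box;
# continuity / bound of the soft-loop observable; measurability of the cold event)

WHAT.  The registered stub `stub_dlrTransferG` (skeleton `Cruxes/SoftLoopLagFloorToTorus/Lines/birth.lean`, objects of
`Theorems/SoftLoopLongLagDefs.lean`) is the DLR law of total covariance through the lag box `Λ_n = lagBox n`, `n = ⌈β^a⌉`, at the
TORUS level with one interior conditioning layer (the cold event of `Λ_n`): an explicit floor `c·R³·β^{-2}` on the lag-`R`
autocovariance of the soft-loop observable `F_R = softLoopObs r R` (`R = ⌈β^ε⌉`) under the cold-conditioned kernel `ν_η = coldKernel`,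
same-datum smoothness of the conditional means, torus large-field rarity (`PlaquetteLargeFieldRarityG`) and cold typicality of the
kernel for crude-good data give, on the window `13ε + 4δ < 2a`, eventually in the torus size `(c/8)·R³·β^{-2} ≤ torusLagCov`.  It is
proved in part 3 (`SoftLoopLongLagSoftLoopLagFloorToTorusStubDlrTransferG`); part 2 (`…DlrTransferKernelsG`) writes the torus covariance
through the box kernels and bounds the bad boundary data; this part supplies, for EVERY compact group `G`:

* §1 `measureReal_mul_condCov_sub_le_cov`, `abs_integral_sub_integral_le_cond` — conditioning a probability measure `γ` on an event
  `A` with `γ(A) ≠ 0`, `γ(Aᶜ) ≤ e`: `γ(A)·Cov_{γ[|A]}(F, G) − 5B²e ≤ Cov_γ(F, G)` and `|γ G − γ F| ≤ |γ[|A] G − γ[|A] F| + 2Be` for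
  `|F|, |G| ≤ B` (elementary; Durrett 2019 §4.1);
* §2 lattice geometry — a lattice walk stays within sup-distance its length of its base point, so the soft loops of `F_R` are
  supported on edges based in `[-5R, 5R]⁴` (`exists_support_softLoopObs`); plaquettes touching `Λ_n` are based in `[-(n+1), n+1]⁴`
  (`≤ 16(2n+3)⁴` of them); `Λ_n` with its collar is based in `[-(n+2), n+2]⁴`; the torus projection is injective on such edge sets;
* §3 `|F_R| ≤ (2R+1)⁴` read as a real polynomial (the lead's `abs_softLoopObs_le`, file `…StubLimitPassageG`, which also gives
  `continuous_softLoopObs`), products bounded by its square, and the cold event is measurable.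

WHAT THIS IS NOT.  No analysis and no claim: plumbing lemmas only.  HONEST LABEL: the crux serves the RECORD-label rung R2xi-G (leaf
`WeakCouplingRates.XiPow`, an UPPER bound on the lattice mass gap for every compact simple `G`); NOT the Clay mass gap; no summit
statement is touched.

References: R. Durrett, *Probability* (2019) §4.1; E. Seiler, LNP 159 (1982) Ch. 2 (Wilson loops are local observables);
S. Friedli, Y. Velenik (2017) §3.2 (boxes and the torus projection).
-/

set_option autoImplicit false

noncomputable section

open MeasureTheory Filter Topology
open Literature.Probability.LatticeModels (Site box mem_box zdGraph zdGraph_adj_iff card_box box_mono)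
open Literature.MathematicalPhysics Literature.MathematicalPhysics.QuantumFieldTheory
open Literature.MathematicalPhysics.QuantumLattice
open Summit.QuantumFields.YangMills.Theorems.WeakCouplingRates
open Summit.QuantumFields.YangMills.Theorems.ColdBoxAllGroups (measurable_plaqCostAtG measureReal_setOf_le_plaqCostAt_eqG)

namespace Summit.QuantumFields.YangMills.Theorems.SoftLoopLongLag

/-! ### §1. Conditioning a probability measure on a typical event -/

section Cond

variable {Ω : Type*} [MeasurableSpace Ω] {γ : Measure Ω} [IsProbabilityMeasure γ] {A : Set Ω}

/-- `∫ f dγ = γ(A) · ∫ f dγ[|A] + ∫_{Aᶜ} f dγ` for an event `A` of positive mass (`γ[|A] = γ(A)⁻¹ · γ|_A`). [folklore] -/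
theorem integral_eq_measureReal_mul_integral_cond_add (hA : MeasurableSet A) (hA0 : γ A ≠ 0) {f : Ω → ℝ}
    (hf : Integrable f γ) :
    ∫ ω, f ω ∂γ = γ.real A * ∫ ω, f ω ∂(ProbabilityTheory.cond γ A) + ∫ ω in Aᶜ, f ω ∂γ := by
  rw [← integral_add_compl hA hf]
  congr 1
  rw [ProbabilityTheory.cond, integral_smul_measure, ENNReal.toReal_inv, smul_eq_mul, ← mul_assoc, measureReal_def,
    mul_inv_cancel₀ (ENNReal.toReal_ne_zero.2 ⟨hA0, measure_ne_top γ A⟩), one_mul]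

/-- **Covariance through conditioning on a typical event.**  For a probability measure `γ`, an event `A` with `γ(A) ≠ 0` and
`γ(Aᶜ) ≤ e`, and measurable `F, G` with `|F|, |G| ≤ B`:
`γ(A) · Cov_{γ[|A]}(F, G) − 5 B² e ≤ Cov_γ(F, G)` (write `γ f = γ(A)·γ[|A] f + ∫_{Aᶜ} f dγ` for `f = F, G, FG` and bound the five
cross terms by `B² γ(Aᶜ)` each; Durrett 2019 §4.1). [folklore] -/
theorem measureReal_mul_condCov_sub_le_cov (hA : MeasurableSet A) (hA0 : γ A ≠ 0) {F G : Ω → ℝ}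
    (hFm : Measurable F) (hGm : Measurable G) {B e : ℝ} (hFB : ∀ ω, |F ω| ≤ B) (hGB : ∀ ω, |G ω| ≤ B)
    (he : γ.real Aᶜ ≤ e) :
    γ.real A * ((∫ ω, F ω * G ω ∂(ProbabilityTheory.cond γ A)) -
        (∫ ω, F ω ∂(ProbabilityTheory.cond γ A)) * ∫ ω, G ω ∂(ProbabilityTheory.cond γ A)) - 5 * B ^ 2 * e ≤
      (∫ ω, F ω * G ω ∂γ) - (∫ ω, F ω ∂γ) * ∫ ω, G ω ∂γ := by
  haveI : IsProbabilityMeasure (ProbabilityTheory.cond γ A) := ProbabilityTheory.cond_isProbabilityMeasure hA0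
  obtain ⟨ω₁⟩ := nonempty_of_isProbabilityMeasure γ
  have hB : 0 ≤ B := (abs_nonneg _).trans (hFB ω₁)
  have bdd : ∀ {f : Ω → ℝ} (C : ℝ) (μ : Measure Ω) [IsFiniteMeasure μ], Measurable f → (∀ ω, |f ω| ≤ C) →
      Integrable f μ := fun C μ _ hf hC =>
    Integrable.of_bound hf.aestronglyMeasurable C (ae_of_all _ fun ω => by simpa [Real.norm_eq_abs] using hC ω)
  have mean : ∀ (f : Ω → ℝ) (C : ℝ) (μ : Measure Ω) [IsProbabilityMeasure μ], (∀ ω, |f ω| ≤ C) →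
      |∫ ω, f ω ∂μ| ≤ C := fun f C μ _ hC => by
    have h := norm_integral_le_of_norm_le_const (μ := μ) (f := f) (C := C) (ae_of_all _ fun ω => by
      rw [Real.norm_eq_abs]; exact hC ω)
    simpa [Real.norm_eq_abs] using h
  have tail : ∀ (f : Ω → ℝ) (C : ℝ), (∀ ω, |f ω| ≤ C) → |∫ ω in Aᶜ, f ω ∂γ| ≤ C * γ.real Aᶜ := fun f C hC => by
    have h := norm_setIntegral_le_of_norm_le_const (μ := γ) (s := Aᶜ) (f := f) (C := C) (measure_lt_top γ _)
      (fun ω _ => by rw [Real.norm_eq_abs]; exact hC ω)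
    simpa [Real.norm_eq_abs] using h
  have hFGB : ∀ ω, |F ω * G ω| ≤ B ^ 2 := fun ω => by
    rw [abs_mul, sq]; exact mul_le_mul (hFB ω) (hGB ω) (abs_nonneg _) hB
  set ν := ProbabilityTheory.cond γ A with hν
  set pc : ℝ := γ.real A with hpc
  set p' : ℝ := γ.real Aᶜ with hp'
  have hp'eq : p' = 1 - pc := probReal_compl_eq_one_sub hA
  have hpc0 : 0 ≤ pc := measureReal_nonneg
  have hp'0 : 0 ≤ p' := measureReal_nonneg
  have hpc1 : pc ≤ 1 := by linarith
  have hp'1 : p' ≤ 1 := by linarith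
  set a : ℝ := ∫ ω, F ω ∂ν with ha
  set b : ℝ := ∫ ω, G ω ∂ν with hb
  set c : ℝ := ∫ ω, F ω * G ω ∂ν with hc
  set rF : ℝ := ∫ ω in Aᶜ, F ω ∂γ with hrF
  set rG : ℝ := ∫ ω in Aᶜ, G ω ∂γ with hrG
  set rFG : ℝ := ∫ ω in Aᶜ, F ω * G ω ∂γ with hrFG
  have eF : ∫ ω, F ω ∂γ = pc * a + rF := integral_eq_measureReal_mul_integral_cond_add hA hA0 (bdd B γ hFm hFB)
  have eG : ∫ ω, G ω ∂γ = pc * b + rG := integral_eq_measureReal_mul_integral_cond_add hA hA0 (bdd B γ hGm hGB)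
  have eFG : ∫ ω, F ω * G ω ∂γ = pc * c + rFG :=
    integral_eq_measureReal_mul_integral_cond_add hA hA0 (bdd (B ^ 2) γ (hFm.mul hGm) hFGB)
  have haB : |a| ≤ B := mean F B ν hFB
  have hbB : |b| ≤ B := mean G B ν hGB
  have hrFB : |rF| ≤ B * p' := tail F B hFB
  have hrGB : |rG| ≤ B * p' := tail G B hGB
  have hrFGB : |rFG| ≤ B ^ 2 * p' := tail (fun ω => F ω * G ω) (B ^ 2) hFGB
  -- the five cross terms
  have hab : |a * b| ≤ B ^ 2 := by rw [abs_mul, sq]; exact mul_le_mul haB hbB (abs_nonneg _) hB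
  have h1 : -(B ^ 2 * p') ≤ pc * p' * (a * b) := by
    have t0 : 0 ≤ pc * p' := mul_nonneg hpc0 hp'0
    have t1 : B ^ 2 * (pc * p') ≤ B ^ 2 * p' := mul_le_mul_of_nonneg_left (by nlinarith) (sq_nonneg B)
    have t2 : pc * p' * -(B ^ 2) ≤ pc * p' * (a * b) := mul_le_mul_of_nonneg_left (abs_le.1 hab).1 t0
    linarith
  have h2 : -(B ^ 2 * p') ≤ rFG := by have := (abs_le.1 hrFGB).1; linarith
  have harG : |a * rG| ≤ B * (B * p') := by rw [abs_mul]; exact mul_le_mul haB hrGB (abs_nonneg _) hB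
  have hbrF : |b * rF| ≤ B * (B * p') := by rw [abs_mul]; exact mul_le_mul hbB hrFB (abs_nonneg _) hB
  have h3 : pc * (a * rG) ≤ B ^ 2 * p' := by
    have t1 : pc * (a * rG) ≤ pc * |a * rG| := mul_le_mul_of_nonneg_left (le_abs_self _) hpc0
    have t2 : pc * |a * rG| ≤ 1 * |a * rG| := mul_le_mul_of_nonneg_right hpc1 (abs_nonneg _)
    nlinarith
  have h4 : pc * (b * rF) ≤ B ^ 2 * p' := by
    have t1 : pc * (b * rF) ≤ pc * |b * rF| := mul_le_mul_of_nonneg_left (le_abs_self _) hpc0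
    have t2 : pc * |b * rF| ≤ 1 * |b * rF| := mul_le_mul_of_nonneg_right hpc1 (abs_nonneg _)
    nlinarith
  have h5 : rF * rG ≤ B ^ 2 * p' := by
    have t1 : |rF * rG| ≤ B * p' * (B * p') := by
      rw [abs_mul]; exact mul_le_mul hrFB hrGB (abs_nonneg _) (by positivity)
    have t2 : B * p' * (B * p') ≤ B ^ 2 * p' := by nlinarith [sq_nonneg B, mul_nonneg (sq_nonneg B) hp'0]
    linarith [le_abs_self (rF * rG)]
  have hB2 : 0 ≤ B ^ 2 := sq_nonneg B
  have hpe : B ^ 2 * p' ≤ B ^ 2 * e := mul_le_mul_of_nonneg_left he hB2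
  have key : pc * p' * (a * b) = pc * (a * b) - pc ^ 2 * (a * b) := by rw [hp'eq]; ring
  rw [eF, eG, eFG]
  linarith

/-- **Means through conditioning on a typical event**: `|γ G − γ F| ≤ |γ[|A] G − γ[|A] F| + 2 B γ(Aᶜ) ≤ |γ[|A] G − γ[|A] F| + 2Be`
for `|F|, |G| ≤ B`, `γ(A) ≠ 0`, `γ(Aᶜ) ≤ e`. [folklore] -/
theorem abs_integral_sub_integral_le_cond (hA : MeasurableSet A) (hA0 : γ A ≠ 0) {F G : Ω → ℝ}
    (hFm : Measurable F) (hGm : Measurable G) {B e : ℝ} (hFB : ∀ ω, |F ω| ≤ B) (hGB : ∀ ω, |G ω| ≤ B)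
    (he : γ.real Aᶜ ≤ e) :
    |(∫ ω, G ω ∂γ) - ∫ ω, F ω ∂γ| ≤
      |(∫ ω, G ω ∂(ProbabilityTheory.cond γ A)) - ∫ ω, F ω ∂(ProbabilityTheory.cond γ A)| + 2 * B * e := by
  haveI : IsProbabilityMeasure (ProbabilityTheory.cond γ A) := ProbabilityTheory.cond_isProbabilityMeasure hA0
  obtain ⟨ω₁⟩ := nonempty_of_isProbabilityMeasure γ
  have hB : 0 ≤ B := (abs_nonneg _).trans (hFB ω₁)
  have bdd : ∀ {f : Ω → ℝ} (C : ℝ), Measurable f → (∀ ω, |f ω| ≤ C) → Integrable f γ := fun C hf hC =>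
    Integrable.of_bound hf.aestronglyMeasurable C (ae_of_all _ fun ω => by simpa [Real.norm_eq_abs] using hC ω)
  have tail : ∀ (f : Ω → ℝ) (C : ℝ), (∀ ω, |f ω| ≤ C) → |∫ ω in Aᶜ, f ω ∂γ| ≤ C * γ.real Aᶜ := fun f C hC => by
    have h := norm_setIntegral_le_of_norm_le_const (μ := γ) (s := Aᶜ) (f := f) (C := C) (measure_lt_top γ _)
      (fun ω _ => by rw [Real.norm_eq_abs]; exact hC ω)
    simpa [Real.norm_eq_abs] using h
  set ν := ProbabilityTheory.cond γ A with hν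
  set pc : ℝ := γ.real A with hpc
  set p' : ℝ := γ.real Aᶜ with hp'
  have hp'eq : p' = 1 - pc := probReal_compl_eq_one_sub hA
  have hpc0 : 0 ≤ pc := measureReal_nonneg
  have hp'0 : 0 ≤ p' := measureReal_nonneg
  have hpc1 : pc ≤ 1 := by linarith
  rw [integral_eq_measureReal_mul_integral_cond_add hA hA0 (bdd B hGm hGB),
    integral_eq_measureReal_mul_integral_cond_add hA hA0 (bdd B hFm hFB)]
  have hrF := tail F B hFB
  have hrG := tail G B hGB
  set a : ℝ := ∫ ω, F ω ∂ν
  set b : ℝ := ∫ ω, G ω ∂ν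
  set rF : ℝ := ∫ ω in Aᶜ, F ω ∂γ
  set rG : ℝ := ∫ ω in Aᶜ, G ω ∂γ
  have hsplit : pc * b + rG - (pc * a + rF) = pc * (b - a) + (rG - rF) := by ring
  rw [hsplit]
  have hBe : B * p' ≤ B * e := mul_le_mul_of_nonneg_left he hB
  calc |pc * (b - a) + (rG - rF)| ≤ |pc * (b - a)| + |rG - rF| := abs_add_le _ _
    _ ≤ pc * |b - a| + (|rG| + |rF|) := by
        rw [abs_mul, abs_of_nonneg hpc0]; exact add_le_add le_rfl (abs_sub _ _)
    _ ≤ 1 * |b - a| + (B * p' + B * p') :=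
        add_le_add (mul_le_mul_of_nonneg_right hpc1 (abs_nonneg _)) (add_le_add hrG hrF)
    _ ≤ |b - a| + 2 * B * e := by linarith

end Cond

/-! ### §2. Lattice geometry: walks, the soft-loop supports, the lag box and its collar -/

section Geometry

/-- Adjacent sites of `ℤ^d` differ by at most `1` in every coordinate. [folklore] -/
theorem abs_sub_le_one_of_zdGraph_adj {d : ℕ} {x z : Site d} (h : (zdGraph d).Adj x z) (k : Fin d) :
    |z k - x k| ≤ 1 := by
  obtain ⟨i, h | h⟩ := (zdGraph_adj_iff x z).1 h
  · rw [h, Pi.add_apply, Pi.single_apply]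
    split_ifs <;> simp
  · rw [h, Pi.add_apply, Pi.single_apply]
    split_ifs <;> simp

/-- A lattice walk stays within sup-distance `length` of its base point. [folklore] -/
theorem abs_sub_le_length_of_mem_support {d : ℕ} :
    ∀ {x y : Site d} (w : (zdGraph d).Walk x y), ∀ v ∈ w.support, ∀ k : Fin d, |v k - x k| ≤ (w.length : ℤ)
  | x, _, .nil, v, hv, k => by
      rw [SimpleGraph.Walk.support_nil, List.mem_singleton] at hv
      rw [hv, sub_self, abs_zero, SimpleGraph.Walk.length_nil, Nat.cast_zero]
  | x, y, .cons (v := z) h w', v, hv, k => by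
      rw [SimpleGraph.Walk.support_cons, List.mem_cons] at hv
      rw [SimpleGraph.Walk.length_cons, Nat.cast_succ]
      rcases hv with rfl | hv
      · rw [sub_self, abs_zero]; positivity
      · have h1 := abs_sub_le_length_of_mem_support w' v hv k
        have h2 := abs_sub_le_one_of_zdGraph_adj h k
        calc |v k - x k| = |(v k - z k) + (z k - x k)| := by ring_nf
          _ ≤ |v k - z k| + |z k - x k| := abs_add_le _ _
          _ ≤ (w'.length : ℤ) + 1 := add_le_add h1 h2

/-- The edge under a dart of a lattice walk is based within sup-distance `length` of the base point. [folklore] -/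
theorem abs_dartStep_sub_le_of_mem_darts {d : ℕ} {x y : Site d} (w : (zdGraph d).Walk x y) {e : (zdGraph d).Dart}
    (he : e ∈ w.darts) (k : Fin d) : |(dartStep e).1.1 k - x k| ≤ (w.length : ℤ) := by
  unfold dartStep
  split_ifs
  · exact abs_sub_le_length_of_mem_support w _ (w.dart_fst_mem_support_of_mem_darts he) k
  · exact abs_sub_le_length_of_mem_support w _ (w.dart_snd_mem_support_of_mem_darts he) k

variable {G : Type} [Group G] [TopologicalSpace G] [IsTopologicalGroup G] [CompactSpace G]
  [MeasurableSpace G] [BorelSpace G]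

omit [IsTopologicalGroup G] [CompactSpace G] [MeasurableSpace G] [BorelSpace G] in
/-- **Support of the soft-loop observable.** `F_R = softLoopObs r R` is a cylinder observable on a finite edge set based in
`[-5R, 5R]⁴` (every loop `rectWalk x 1 2 R R`, `x ∈ [-R, R]⁴`, has length `4R`). [folklore] -/
theorem exists_support_softLoopObs (r : LatticeRep G) (R : ℕ) :
    ∃ S : Finset (QuantumLattice.ZdEdge 4), IsCylinder (softLoopObs r R) S ∧ ∀ e ∈ S, e.1 ∈ box 4 (5 * R) := by
  classical
  refine ⟨((box 4 R).filter (fun x => x 0 = 0)).biUnion fun x =>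
      ((rectWalk x 1 2 R R).darts.map fun e => (dartStep e).1).toFinset, ?_, ?_⟩
  · intro U V hUV
    simp only [softLoopObs]
    refine Finset.sum_congr rfl fun x hx => ?_
    refine isCylinder_wilsonLoopObs _ (rectWalk x 1 2 R R) (fun e he => hUV e ?_)
    simp only [Finset.coe_biUnion, Finset.mem_coe, Set.mem_iUnion]
    exact ⟨x, hx, he⟩
  · intro e he
    simp only [Finset.mem_biUnion, List.mem_toFinset, List.mem_map] at he
    obtain ⟨x, hx, e', he', rfl⟩ := he
    have hxR := mem_box.1 (Finset.mem_filter.1 hx).1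
    rw [mem_box]
    intro k
    have h1 := abs_dartStep_sub_le_of_mem_darts (rectWalk x 1 2 R R) he' k
    rw [length_rectWalk] at h1
    have h2 := hxR k
    rw [abs_le] at h1
    push_cast at h1 ⊢
    constructor <;> omega

omit [Group G] [TopologicalSpace G] [IsTopologicalGroup G] [CompactSpace G] [BorelSpace G] in
/-- Edges based in `[-M, M]⁴` shifted by `t e₀` are based in `[-(M+t), M+t]⁴` (support of `F ∘ α_t`, `isCylinder_timeShift`). [folklore] -/
theorem fst_mem_box_of_mem_image_shift {M t : ℕ} {S : Finset (QuantumLattice.ZdEdge 4)} (hS : ∀ e ∈ S, e.1 ∈ box 4 M)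
    {e : QuantumLattice.ZdEdge 4} (he : e ∈ S.image fun e => (e.1 + Pi.single 0 (t : ℤ), e.2)) : e.1 ∈ box 4 (M + t) := by
  obtain ⟨e', he', rfl⟩ := Finset.mem_image.1 he
  have h := mem_box.1 (hS e' he')
  rw [mem_box]
  intro k
  have hk := h k
  simp only [Pi.add_apply, Pi.single_apply]
  push_cast
  split_ifs <;> constructor <;> omega

/-- Plaquettes touching the lag box `Λ_n` are based in `[-(n+1), n+1]⁴`. [folklore] -/
theorem fst_mem_box_of_mem_plaquettesTouching_lagBox {n : ℕ} {p : ZdPlaquette 4}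
    (hp : p ∈ plaquettesTouching (lagBox n)) : p.1 ∈ box 4 (n + 1) := by
  obtain ⟨e, he⟩ := mem_plaquettesTouching_iff.1 hp
  rw [Finset.mem_inter] at he
  have h1 := coord_of_mem_plaquetteEdges he.1
  have h2 : e.1 ∈ box 4 n := (Finset.mem_product.1 he.2).1
  rw [mem_box] at h2 ⊢
  intro k
  have h1k := h1 k
  have h2k := h2 k
  push_cast
  constructor <;> omega

/-- At most `16 (2n+3)⁴` plaquettes touch the lag box `Λ_n` (base point in `[-(n+1), n+1]⁴`, `≤ 16` planes). [folklore] -/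
theorem card_plaquettesTouching_lagBox_le (n : ℕ) :
    ((plaquettesTouching (lagBox n)).card : ℝ) ≤ 16 * (2 * (n : ℝ) + 3) ^ 4 := by
  classical
  have hsub : plaquettesTouching (lagBox n) ⊆ (box 4 (n + 1)) ×ˢ Finset.univ := fun p hp =>
    Finset.mem_product.2 ⟨fst_mem_box_of_mem_plaquettesTouching_lagBox hp, Finset.mem_univ _⟩
  have h := Finset.card_le_card hsub
  rw [Finset.card_product, card_box, Finset.card_univ] at h
  have h6 : Fintype.card {p : Fin 4 × Fin 4 // p.1 < p.2} ≤ 16 :=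
    (Fintype.card_subtype_le _).trans (by simp)
  have h' : (plaquettesTouching (lagBox n)).card ≤ (2 * (n + 1) + 1) ^ 4 * 16 := h.trans (Nat.mul_le_mul_left _ h6)
  calc ((plaquettesTouching (lagBox n)).card : ℝ) ≤ ((2 * (n + 1) + 1) ^ 4 * 16 : ℕ) := by exact_mod_cast h'
    _ = 16 * (2 * (n : ℝ) + 3) ^ 4 := by push_cast; ring

/-- The lag box `Λ_n` with its collar (the edges of the plaquettes touching it) is based in `[-(n+2), n+2]⁴`. [folklore] -/
theorem fst_mem_box_of_mem_lagBox_union_collar {n : ℕ} {e : QuantumLattice.ZdEdge 4}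
    (he : e ∈ lagBox n ∪ (plaquettesTouching (lagBox n)).biUnion plaquetteEdges) : e.1 ∈ box 4 (n + 2) := by
  rcases Finset.mem_union.1 he with he | he
  · have h2 : e.1 ∈ box 4 n := (Finset.mem_product.1 he).1
    exact box_mono 4 (by omega) h2
  · obtain ⟨q, hq, heq⟩ := Finset.mem_biUnion.1 he
    have h1 := mem_box.1 (fst_mem_box_of_mem_plaquettesTouching_lagBox hq)
    have h2 := coord_of_mem_plaquetteEdges heq
    rw [mem_box]
    intro k
    have h1k := h1 k
    have h2k := h2 k
    push_cast at h1k ⊢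
    constructor <;> omega

/-- `Torus.proj L` is injective on the base points of a finite edge set based in `[-M, M]⁴` once `2M < L`. [folklore] -/
theorem injOn_torusProj_image_fst {M L : ℕ} (hML : 2 * M < L) {T : Finset (QuantumLattice.ZdEdge 4)}
    (hT : ∀ e ∈ T, e.1 ∈ box 4 M) :
    Set.InjOn (Literature.Probability.LatticeModels.Torus.proj L) (T.image Prod.fst : Set (Site 4)) := by
  intro x hx y hy hxy
  obtain ⟨e, he, rfl⟩ := Finset.mem_image.1 (Finset.mem_coe.1 hx)
  obtain ⟨e', he', rfl⟩ := Finset.mem_image.1 (Finset.mem_coe.1 hy)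
  exact Literature.Probability.LatticeModels.torusProj_injOn_box hML (hT e he) (hT e' he') hxy

end Geometry

/-! ### §3. The soft-loop observable: bound, and the measurability of the cold event -/

section Observable

variable {G : Type} [Group G] [TopologicalSpace G] [IsTopologicalGroup G] [CompactSpace G]
  [MeasurableSpace G] [BorelSpace G]

omit [MeasurableSpace G] [BorelSpace G] in
/-- `|softLoopObs r R| ≤ (2R+1)⁴` with the bound read as a real polynomial in `R` (the lead's `abs_softLoopObs_le` of
`…StubLimitPassageG`, cast). [folklore] -/
theorem abs_softLoopObs_le' (r : LatticeRep G) (R : ℕ) (U : LGConfig 4 G) :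
    |softLoopObs r R U| ≤ (2 * (R : ℝ) + 1) ^ 4 := by
  have h := abs_softLoopObs_le r R U
  push_cast at h
  exact h

omit [BorelSpace G] in
/-- Products `F_R · (F_R ∘ α_t)` are bounded by `((2R+1)⁴)²`. [folklore] -/
theorem abs_softLoopObs_mul_le (r : LatticeRep G) (R t : ℕ) (U : LGConfig 4 G) :
    |softLoopObs r R U * softLoopObs r R (timeShiftLG (G := G) t U)| ≤ ((2 * (R : ℝ) + 1) ^ 4) ^ 2 := by
  rw [abs_mul, sq]
  exact mul_le_mul (abs_softLoopObs_le' r R U) (abs_softLoopObs_le' r R _) (abs_nonneg _) (by positivity)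

omit [CompactSpace G] in
/-- The cold event of an edge set is measurable (a finite intersection of closed half-spaces of plaquette costs). [folklore] -/
theorem measurableSet_coldEvent [SecondCountableTopology G] (r : LatticeRep G) (β κ : ℝ)
    (Λ : Finset (QuantumLattice.ZdEdge 4)) : MeasurableSet (coldEvent r β κ Λ) := by
  have hset : coldEvent r β κ Λ =
      ⋂ p ∈ plaquettesTouching Λ, {U : LGConfig 4 G | plaqCostAt r.ρ p.1 p.2.1.1 p.2.1.2 U ≤ β ^ (κ - 1)} := by
    ext U
    simp only [coldEvent, Set.mem_setOf_eq, Set.mem_iInter, plaqCostAt]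
  rw [hset]
  exact Finset.measurableSet_biInter _ fun p _ =>
    measurableSet_le (measurable_plaqCostAtG r.ρ r.continuous _ _ _) measurable_const

end Observable

end Summit.QuantumFields.YangMills.Theorems.SoftLoopLongLag

end
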